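import Mathlib

/-!
# Route `FilamentSkeletonRss` · crux `SkeletonJ1R` (stmt-NavierStokesRegularity-23610) · registered line `streamline_kantorovich_R`
# — brick K-§3b (tools) for stub K `KantorovichClosingL`: the nonlinearity of the branch equation of the unstable curve

Hand `ns-filament-21221-p1` (g18), `--supports stmt-NavierStokesRegularity-23610 --as helper`; pure Mathlib, route-independent.

WHY.  Tool lemmas for `…SkeletonJ1RUnstableCurve.lean` (the `C¹` unstable curve of an equilibrium by the parameterization method; K-notes §3
of the lead).  Writing the solution of the singular invariance equation `λ s P′(s) = f(P(s))` as `P(s) = p + s q(σ s)` (`σ = ±1`, the two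
sides of `s = 0`) gives the branch equation `s q′ = K₀ q + s H_σ(s, q)` with `K₀ = λ⁻¹ Df(p) − 1` and
`H_σ(s, q) = σ (λ s²)⁻¹ g(σ s q)`, `g(v) = f(p + v) − Df(p) v`.  Here: (§1) the Taylor remainder `g` of a map with `Df` Lipschitz at `p`
is `ω r`-Lipschitz on `B̄(0, r)` and `‖g(v)‖ ≤ ω‖v‖²` (mean-value inequality); (§2) `branchH` = `H_σ` and `branchH_estimates`: bounded by
`ω(‖ξ‖+R)²/λ`, `(ω(‖ξ‖+R)/λ)`-Lipschitz in `q` and jointly continuous on `(0, δ₀] × B̄(ξ, R)` when `δ₀(‖ξ‖+R) < ρ₀`; (§3) the growth bound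
`‖exp(tA) Π v‖ ≤ C e^{λt}‖Π v‖` gives the bounded forward semigroup `‖exp(tK₀) Π v‖ ≤ C‖Π v‖`, and the scalar algebra turning the branch
equation back into the invariance equation.

HONEST FRAMING.  Calculus bookkeeping for a sub-brick of an OPEN stub (K) of the ∃-side of a HYPOTHETICAL filament-type rotating-self-similar
blow-up skeleton (MODEL rung, negative side); nothing here is a claim about Navier–Stokes regularity or blow-up; stub K and the crux stay OPEN.
-/

set_option linter.dupNamespace false -- `NavierStokesRegularity.NavierStokesRegularity` path/namespace repetition is the tree convention

noncomputable section

namespace Summit.NavierStokesRegularity.NavierStokesRegularity.Theorems.SkeletonJ1RUnstableCurve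

open Set Function Filter Metric NormedSpace
open scoped Topology

variable {E : Type*} [NormedAddCommGroup E] [NormedSpace ℝ E] [CompleteSpace E]

/-! ## §1 The remainder `g(v) = f(p + v) − Df(p) v` of a map with `Df` Lipschitz at `p` -/

omit [CompleteSpace E] in
/-- Mean-value bound for the Taylor remainder: if `f` is differentiable on `B(p, ρ₀)` with `‖Df(y) − Df(p)‖ ≤ ω ‖y − p‖` (`ω ≥ 0`),
then `g(v) = f(p+v) − Df(p) v` is `ω r`-Lipschitz on the closed ball `B̄(0, r)`, `r < ρ₀`. [folklore] -/
theorem norm_remainder_sub_le {f : E → E} {f' : E → E →L[ℝ] E} {p : E} {ω ρ₀ r : ℝ} (hω : 0 ≤ ω)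
    (hfd : ∀ y ∈ ball p ρ₀, HasFDerivAt f (f' y) y) (hlip : ∀ y ∈ ball p ρ₀, ‖f' y - f' p‖ ≤ ω * ‖y - p‖)
    (hr : r < ρ₀) {v w : E} (hv : ‖v‖ ≤ r) (hw : ‖w‖ ≤ r) :
    ‖(f (p + v) - f' p v) - (f (p + w) - f' p w)‖ ≤ ω * r * ‖v - w‖ := by
  set g : E → E := fun u => f (p + u) - f' p u with hg
  have hball : ∀ u ∈ closedBall (0 : E) r, p + u ∈ ball p ρ₀ := fun u hu => by
    rw [mem_ball, dist_eq_norm, add_sub_cancel_left]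
    exact lt_of_le_of_lt (mem_closedBall_zero_iff.1 hu) hr
  have hgd : ∀ u ∈ closedBall (0 : E) r, HasFDerivWithinAt g (f' (p + u) - f' p) (closedBall 0 r) u := by
    intro u hu
    have h1 : HasFDerivAt (fun u => f (p + u)) (f' (p + u)) u := by
      have h := (hfd _ (hball u hu)).comp u ((hasFDerivAt_id u).const_add p)
      simpa [Function.comp_def] using h
    exact (h1.sub (f' p).hasFDerivAt).hasFDerivWithinAt
  have hgb : ∀ u ∈ closedBall (0 : E) r, ‖f' (p + u) - f' p‖ ≤ ω * r := fun u hu => by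
    have h := hlip _ (hball u hu)
    rw [add_sub_cancel_left] at h
    exact h.trans (mul_le_mul_of_nonneg_left (mem_closedBall_zero_iff.1 hu) hω)
  have h := (convex_closedBall (0 : E) r).norm_image_sub_le_of_norm_hasFDerivWithin_le hgd hgb
    (mem_closedBall_zero_iff.2 hw) (mem_closedBall_zero_iff.2 hv)
  simpa [hg] using h

omit [CompleteSpace E] in
/-- Size of the Taylor remainder: `‖f(p+v) − Df(p) v‖ ≤ ω ‖v‖²` for `‖v‖ < ρ₀` (`f p = 0`). [folklore] -/
theorem norm_remainder_le {f : E → E} {f' : E → E →L[ℝ] E} {p : E} {ω ρ₀ : ℝ} (hω : 0 ≤ ω) (hf0 : f p = 0)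
    (hfd : ∀ y ∈ ball p ρ₀, HasFDerivAt f (f' y) y) (hlip : ∀ y ∈ ball p ρ₀, ‖f' y - f' p‖ ≤ ω * ‖y - p‖)
    {v : E} (hv : ‖v‖ < ρ₀) : ‖f (p + v) - f' p v‖ ≤ ω * ‖v‖ * ‖v‖ := by
  have h := norm_remainder_sub_le hω hfd hlip hv (le_refl ‖v‖) (w := 0) (by simp)
  simpa [hf0] using h

/-! ## §2 The nonlinearity `H_σ(s, q) = σ (λ s²)⁻¹ g(σ s q)` of the branch equation (`σ = ±1`: the two sides of `s = 0`) -/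

omit [CompleteSpace E] in
/-- The nonlinearity `H_σ(s, q) = σ • (λ s²)⁻¹ • (f(p + (σ s) q) − Df(p)[(σ s) q])` of the regular-branch equation
`s q′ = K₀ q + s H_σ(s, q)` (obtained from the invariance equation by `P(s) = p + s q(σ s)`, `σ = ±1`): on `(0, δ₀] × B̄(ξ, R)` with
`δ₀ (‖ξ‖ + R) < ρ₀` it is bounded by `ω(‖ξ‖+R)²/λ`, `(ω(‖ξ‖+R)/λ)`-Lipschitz in `q`, and jointly continuous. [folklore] -/
theorem branchH_estimates {f : E → E} {f' : E → E →L[ℝ] E} {H : ℝ → E → E} {p ξ : E} {lam ω ρ₀ δ₀ R σ : ℝ}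
    (hlam : 0 < lam) (hω : 0 ≤ ω) (hR : 0 ≤ R) (hσ : σ = 1 ∨ σ = -1) (hρ : δ₀ * (‖ξ‖ + R) < ρ₀)
    (hf0 : f p = 0) (hfd : ∀ y ∈ ball p ρ₀, HasFDerivAt f (f' y) y)
    (hlip : ∀ y ∈ ball p ρ₀, ‖f' y - f' p‖ ≤ ω * ‖y - p‖)
    (hH : ∀ s q, H s q = σ • ((lam * s ^ 2)⁻¹ • (f (p + (σ * s) • q) - f' p ((σ * s) • q)))) :
    (∀ s ∈ Ioc 0 δ₀, ∀ q ∈ closedBall ξ R, ‖H s q‖ ≤ ω * (‖ξ‖ + R) ^ 2 / lam) ∧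
    (∀ s ∈ Ioc 0 δ₀, ∀ q ∈ closedBall ξ R, ∀ q' ∈ closedBall ξ R,
      ‖H s q - H s q'‖ ≤ ω * (‖ξ‖ + R) / lam * ‖q - q'‖) ∧
    ContinuousOn (uncurry H) (Ioc 0 δ₀ ×ˢ closedBall ξ R) := by
  have hσ1 : |σ| = 1 := by rcases hσ with rfl | rfl <;> simp
  have hσs : ∀ s : ℝ, ‖σ * s‖ = |s| := fun s => by rw [Real.norm_eq_abs, abs_mul, hσ1, one_mul]
  -- `‖q‖ ≤ ‖ξ‖ + R` on the ball, hence `‖(σ s) • q‖ ≤ s (‖ξ‖ + R) < ρ₀`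
  have hqn : ∀ q ∈ closedBall ξ R, ‖q‖ ≤ ‖ξ‖ + R := fun q hq => by
    have h : ‖q - ξ‖ ≤ R := by rwa [mem_closedBall, dist_eq_norm] at hq
    calc ‖q‖ = ‖ξ + (q - ξ)‖ := by rw [add_sub_cancel]
      _ ≤ ‖ξ‖ + ‖q - ξ‖ := norm_add_le _ _
      _ ≤ ‖ξ‖ + R := by gcongr
  have hsq : ∀ s ∈ Ioc (0 : ℝ) δ₀, ∀ q ∈ closedBall ξ R, ‖(σ * s) • q‖ ≤ s * (‖ξ‖ + R) := fun s hs q hq => by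
    rw [norm_smul, hσs, abs_of_pos hs.1]; exact mul_le_mul_of_nonneg_left (hqn q hq) hs.1.le
  have hsρ : ∀ s ∈ Ioc (0 : ℝ) δ₀, s * (‖ξ‖ + R) < ρ₀ := fun s hs =>
    lt_of_le_of_lt (mul_le_mul_of_nonneg_right hs.2 (by positivity)) hρ
  refine ⟨fun s hs q hq => ?_, fun s hs q hq q' hq' => ?_, ?_⟩
  · -- bound
    have hs2 : 0 < lam * s ^ 2 := by have := hs.1; positivity
    have hg := norm_remainder_le hω hf0 hfd hlip (lt_of_le_of_lt (hsq s hs q hq) (hsρ s hs))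
    simp only [hH, norm_smul, Real.norm_eq_abs, hσ1, one_mul, norm_inv, abs_of_pos hs2]
    rw [inv_mul_le_iff₀ hs2]
    calc ‖f (p + (σ * s) • q) - (f' p) ((σ * s) • q)‖ ≤ ω * ‖(σ * s) • q‖ * ‖(σ * s) • q‖ := hg
      _ ≤ ω * (s * (‖ξ‖ + R)) * (s * (‖ξ‖ + R)) := by
          have h1 := hsq s hs q hq
          have h0 : 0 ≤ ‖(σ * s) • q‖ := norm_nonneg _
          exact mul_le_mul (mul_le_mul_of_nonneg_left h1 hω) h1 h0 (by have := hs.1; positivity)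
      _ = lam * s ^ 2 * (ω * (‖ξ‖ + R) ^ 2 / lam) := by field_simp
  · -- Lipschitz
    have hs2 : 0 < lam * s ^ 2 := by have := hs.1; positivity
    have hg := norm_remainder_sub_le hω hfd hlip (hsρ s hs) (hsq s hs q hq) (hsq s hs q' hq')
    have e : H s q - H s q'
        = σ • ((lam * s ^ 2)⁻¹ • ((f (p + (σ * s) • q) - f' p ((σ * s) • q))
            - (f (p + (σ * s) • q') - f' p ((σ * s) • q')))) := by
      simp only [hH, ← smul_sub]
    rw [e, norm_smul, norm_smul, Real.norm_eq_abs, hσ1, one_mul, norm_inv, Real.norm_eq_abs, abs_of_pos hs2,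
      inv_mul_le_iff₀ hs2]
    calc ‖(f (p + (σ * s) • q) - f' p ((σ * s) • q)) - (f (p + (σ * s) • q') - f' p ((σ * s) • q'))‖
        ≤ ω * (s * (‖ξ‖ + R)) * ‖(σ * s) • q - (σ * s) • q'‖ := hg
      _ = ω * (s * (‖ξ‖ + R)) * (s * ‖q - q'‖) := by rw [← smul_sub, norm_smul, hσs, abs_of_pos hs.1]
      _ = lam * s ^ 2 * (ω * (‖ξ‖ + R) / lam * ‖q - q'‖) := by field_simp
  · -- continuity: `f` is continuous on the ball, the rest is algebra
    have hfc : ContinuousOn f (ball p ρ₀) := fun y hy => (hfd y hy).continuousAt.continuousWithinAt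
    have hmaps : MapsTo (fun z : ℝ × E => p + (σ * z.1) • z.2) (Ioc 0 δ₀ ×ˢ closedBall ξ R) (ball p ρ₀) := by
      intro z hz
      rw [mem_ball, dist_eq_norm, add_sub_cancel_left]
      exact lt_of_le_of_lt (hsq z.1 hz.1 z.2 hz.2) (hsρ z.1 hz.1)
    have h1 : ContinuousOn (fun z : ℝ × E => (σ * z.1) • z.2) (Ioc 0 δ₀ ×ˢ closedBall ξ R) :=
      ((continuous_const.mul continuous_fst).smul continuous_snd).continuousOn
    have h2 : ContinuousOn (fun z : ℝ × E => f (p + (σ * z.1) • z.2)) (Ioc 0 δ₀ ×ˢ closedBall ξ R) :=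
      hfc.comp (continuousOn_const.add h1) hmaps
    have h3 : ContinuousOn (fun z : ℝ × E => (lam * z.1 ^ 2)⁻¹) (Ioc 0 δ₀ ×ˢ closedBall ξ R) :=
      ((continuous_const.mul (continuous_fst.pow 2)).continuousOn).inv₀ fun z hz =>
        (mul_pos hlam (pow_pos hz.1.1 2)).ne'
    have h4 : ContinuousOn (fun z : ℝ × E => f' p ((σ * z.1) • z.2)) (Ioc 0 δ₀ ×ˢ closedBall ξ R) :=
      (f' p).continuous.comp_continuousOn h1
    have h : ContinuousOn (fun z : ℝ × E => σ • ((lam * z.1 ^ 2)⁻¹ • (f (p + (σ * z.1) • z.2) - f' p ((σ * z.1) • z.2))))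
        (Ioc 0 δ₀ ×ˢ closedBall ξ R) := (h3.smul (h2.sub h4)).const_smul σ
    exact h.congr fun z _ => hH z.1 z.2

/-! ## §3 The linear part `K₀ = λ⁻¹A − 1` and the algebra of the substitution -/

/-- From the growth bound `‖exp(tA) Π v‖ ≤ C e^{λt} ‖Π v‖` (`t ≥ 0`) to the bounded forward semigroup of `K₀ = λ⁻¹A − 1` on the range
of `Π`: `‖exp(t K₀) Π v‖ ≤ C ‖Π v‖` (`exp(tK₀) = e^{−t} exp((t/λ)A)`). [folklore] -/
theorem norm_exp_smul_branchK_apply_le {A Pr : E →L[ℝ] E} {lam C : ℝ} (hlam : 0 < lam)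
    (hexpA : ∀ t : ℝ, 0 ≤ t → ∀ v : E, ‖exp (t • A) (Pr v)‖ ≤ C * Real.exp (lam * t) * ‖Pr v‖)
    (t : ℝ) (ht : 0 ≤ t) (v : E) : ‖exp (t • (lam⁻¹ • A - 1)) (Pr v)‖ ≤ C * ‖Pr v‖ := by
  letI : NormedAlgebra ℚ (E →L[ℝ] E) := NormedAlgebra.restrictScalars ℚ ℝ (E →L[ℝ] E)
  have hsplit : t • (lam⁻¹ • A - 1) = (t * lam⁻¹) • A + (-t) • (1 : E →L[ℝ] E) := by
    rw [smul_sub, smul_smul, neg_smul, sub_eq_add_neg]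
  have hcomm : Commute ((t * lam⁻¹) • A) ((-t) • (1 : E →L[ℝ] E)) :=
    ((Commute.one_right A).smul_left _).smul_right _
  have hone : exp ((-t) • (1 : E →L[ℝ] E)) = Real.exp (-t) • (1 : E →L[ℝ] E) := by
    rw [← Algebra.algebraMap_eq_smul_one, ← Algebra.algebraMap_eq_smul_one, Real.exp_eq_exp_ℝ, algebraMap_exp_comm]
  have e : exp (t • (lam⁻¹ • A - 1)) (Pr v) = Real.exp (-t) • exp ((t * lam⁻¹) • A) (Pr v) := by
    rw [hsplit, exp_add_of_commute hcomm, hone, mul_smul_comm, mul_one]; rfl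
  rw [e, norm_smul, Real.norm_of_nonneg (Real.exp_nonneg _)]
  have h := hexpA (t * lam⁻¹) (by positivity) v
  have hlt : lam * (t * lam⁻¹) = t := by field_simp
  rw [hlt] at h
  calc Real.exp (-t) * ‖exp ((t * lam⁻¹) • A) (Pr v)‖ ≤ Real.exp (-t) * (C * Real.exp t * ‖Pr v‖) :=
        mul_le_mul_of_nonneg_left h (Real.exp_nonneg _)
    _ = C * ‖Pr v‖ := by
        have : Real.exp (-t) * Real.exp t = 1 := by rw [← Real.exp_add, neg_add_cancel, Real.exp_zero]
        calc Real.exp (-t) * (C * Real.exp t * ‖Pr v‖) = (Real.exp (-t) * Real.exp t) * (C * ‖Pr v‖) := by ring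
          _ = C * ‖Pr v‖ := by rw [this, one_mul]

omit [CompleteSpace E] in
/-- The algebra that turns the branch equation back into the invariance equation: if `u q′ = (λ⁻¹A − 1) q + u·σ(λu²)⁻¹ w` with
`σ² = 1`, then `λ (σu) · (q + u q′) = (σ u) A q + w`. [folklore] -/
theorem smul_add_eq_of_branchODE {A : E →L[ℝ] E} {lam u σ : ℝ} {q q' w : E} (hlam : lam ≠ 0) (hu : u ≠ 0)
    (hσ : σ * σ = 1) (hode : u • q' = (lam⁻¹ • A - 1) q + u • (σ • ((lam * u ^ 2)⁻¹ • w))) :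
    (lam * (σ * u)) • (q + u • q') = (σ * u) • A q + w := by
  have k1 : (lam * (σ * u)) • ((lam⁻¹ • A - 1) q) = (σ * u) • A q - (lam * (σ * u)) • q := by
    show (lam * (σ * u)) • (lam⁻¹ • A q - q) = _
    rw [smul_sub, smul_smul, show lam * (σ * u) * lam⁻¹ = σ * u by field_simp]
  have k2 : (lam * (σ * u)) • (u • (σ • ((lam * u ^ 2)⁻¹ • w))) = w := by
    have hsc : lam * (σ * u) * u * σ * (lam * u ^ 2)⁻¹ = 1 := by
      have hne : lam * u ^ 2 ≠ 0 := mul_ne_zero hlam (pow_ne_zero 2 hu)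
      calc lam * (σ * u) * u * σ * (lam * u ^ 2)⁻¹ = (σ * σ) * ((lam * u ^ 2) * (lam * u ^ 2)⁻¹) := by ring
        _ = 1 := by rw [hσ, mul_inv_cancel₀ hne, one_mul]
    rw [smul_smul, smul_smul, smul_smul, hsc, one_smul]
  rw [smul_add, hode, smul_add, k1, k2]
  abel

end Summit.NavierStokesRegularity.NavierStokesRegularity.Theorems.SkeletonJ1RUnstableCurve

end
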